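import Summits.BirchSwinnertonDyer.BirchSwinnertonDyer.Theorems.ByReductionTypeAtTwoOrdKatoOptimalLedger
import Summits.BirchSwinnertonDyer.BirchSwinnertonDyer.Theorems.ByReductionTypeAtTwoAnalyticMuZeroShapes
import Summits.BirchSwinnertonDyer.BirchSwinnertonDyer.Theorems.ByReductionTypeAtTwoOrdKatoHalfAtTwoIsoHintOfAbbesUllmo
import Summits.BirchSwinnertonDyer.BirchSwinnertonDyer.Theorems.ByReductionTypeAtTwoOrdKatoHalfAtTwoIsoOptimalOff514Defs
import Summits.BirchSwinnertonDyer.BirchSwinnertonDyer.Theorems.ByReductionTypeAtTwoOrdKatoHalfAtTwoIsoSignFreeDefs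
import Summits.BirchSwinnertonDyer.BirchSwinnertonDyer.Theorems.ByReductionTypeAtTwoOrdKatoHalfAtTwoIsoZetaColemanMuIotaChain
import Summits.BirchSwinnertonDyer.BirchSwinnertonDyer.Theorems.ByReductionTypeAtTwoOrdKatoHalfAtTwoIsoCoreTheoremAPosDisc
import Summits.BirchSwinnertonDyer.BirchSwinnertonDyer.Theorems.ByReductionTypeAtTwoOrdKatoHalfAtTwoIsoPosDiscSplit
import Summits.BirchSwinnertonDyer.BirchSwinnertonDyer.Theorems.ByReductionTypeAtTwoOrdKatoHalfAtTwoIsoPosDiscEpsilonDefs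
import Summits.BirchSwinnertonDyer.BirchSwinnertonDyer.Theorems.ByReductionTypeAtTwoOrdKatoHalfAtTwoIsoPosDiscEpsilon
import Summits.BirchSwinnertonDyer.BirchSwinnertonDyer.Theorems.ByReductionTypeAtTwoOrdKatoHalfAtTwoIsoPosDiscNecessity
import Summits.BirchSwinnertonDyer.BirchSwinnertonDyer.Theorems.ByReductionTypeAtTwoOrdKatoHalfAtTwoIsoPosDiscNecessityTwist
import Summits.BirchSwinnertonDyer.BirchSwinnertonDyer.Theorems.ByReductionTypeAtTwoOrdKatoHalfAtTwoIsoGreenbergMuDefs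
import Summits.BirchSwinnertonDyer.Rank1Residual.GreenbergMuConjecture
import Summits.BirchSwinnertonDyer.BirchSwinnertonDyer.Theorems.ByReductionTypeAtTwoOrdKatoHalfAtTwoIsoColemanHalfClassCells
import Summits.BirchSwinnertonDyer.BirchSwinnertonDyer.Theorems.ByReductionTypeAtTwoOrdKatoHalfAtTwoIsoColemanHalfClassOff514
import Summits.BirchSwinnertonDyer.BirchSwinnertonDyer.Theorems.ByReductionTypeAtTwoOrdKatoHalfAtTwoIsoPosDiscRealSignature
import Summits.BirchSwinnertonDyer.BirchSwinnertonDyer.Theorems.ByReductionTypeAtTwoOrdKatoHalfAtTwoIsoPosDiscSmallCarrier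
import Summits.BirchSwinnertonDyer.BirchSwinnertonDyer.Theorems.ByReductionTypeAtTwoOrdKatoHalfAtTwoIsoRelaxedRoadsLemma46
import Summits.BirchSwinnertonDyer.BirchSwinnertonDyer.Theorems.ByReductionTypeAtTwoOrdKatoHalfAtTwoIsoConjATwoOfPointFieldMu
import Summits.BirchSwinnertonDyer.BirchSwinnertonDyer.Theorems.ByReductionTypeAtTwoOrdKatoHalfAtTwoIsoZetaColemanMuIotaKatoCarriers
import Summits.BirchSwinnertonDyer.BirchSwinnertonDyer.Theorems.ByReductionTypeAtTwoOrdKatoHalfAtTwoIsoColemanMuSpanFreeKatoCarriers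
import Literature.NumberTheory.EllipticCurves.Kato2004.LocalIwasawaCohomologyTateDuality
import Summits.BirchSwinnertonDyer.BirchSwinnertonDyer.Theorems.ByReductionTypeAtTwoOrdKatoHalfAtTwoIsoColemanMuFreeValue
import Literature.NumberTheory.EllipticCurves.Kato2004.LocalIwasawaCohomologyOrdinaryQuotient
import Literature.NumberTheory.EllipticCurves.FineSelmerLimThm35AtTwoUpstairsProofs
import Summits.BirchSwinnertonDyer.BirchSwinnertonDyer.Theorems.ByReductionTypeAtTwoOrdKatoHalfAtTwoIsoSteinbergDefs
import Summits.BirchSwinnertonDyer.BirchSwinnertonDyer.Theorems.ByReductionTypeAtTwoOrdKatoHalfAtTwoIsoOmegaRoadDefs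
import Summits.BirchSwinnertonDyer.BirchSwinnertonDyer.Theorems.ByReductionTypeAtTwoOrdKatoHalfAtTwoIsoChebotarevTranspositionTwo
import Summits.BirchSwinnertonDyer.BirchSwinnertonDyer.Theorems.ByReductionTypeAtTwoOrdKatoHalfAtTwoIsoSelmerSideTwo
import Summits.BirchSwinnertonDyer.BirchSwinnertonDyer.Theorems.ByReductionTypeAtTwoOrdKatoHalfAtTwoIsoKolyvaginRankOneTwo
import Summits.BirchSwinnertonDyer.Rank1Residual.X10.CoreTheoremAOddPrime
import Summits.BirchSwinnertonDyer.Rank1Residual.X5.KatoOrdTwoMuPart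
import Summits.BirchSwinnertonDyer.Rank1Residual.X5.TwoAdicImageCriteriaLift
import Literature.NumberTheory.EllipticCurves.Kato2004.EulerSystemBoundFineSelmerTwo
import Literature.NumberTheory.EllipticCurves.TwoAdicImageGoodOrdinaryAtTwoProofs
import Literature.NumberTheory.EllipticCurves.PAdicLFunctionIntegralityAtTwoAutoProofs
import Literature.NumberTheory.EllipticCurves.NonEisensteinPrimeOfSurjective
import Literature.NumberTheory.EllipticCurves.IwasawaAlgebraInvolution
import HarnessLib
import Summits.BirchSwinnertonDyer.BirchSwinnertonDyer.Theorems.ByReductionTypeAtTwoOrdKatoHalfAtTwoIsoMuFreeValueNegOfGreenbergMu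
import Literature.NumberTheory.EllipticCurves.Kato2004.IwasawaH1FreeOfNoRationalTorsionProofs
/-!
# Cert54b — crux-triage r1 seat 2, GEN 54 (2026-08-29): the registered `Δ < 0` memo stub V♭⁻ of skeleton v24 (`4921f2ec…`) priced
# against N2D⁻ («some GENUINE `2`-adic Euler-system class is NOT `2`-divisible in `𝐇¹_Γ(T₂W)`») — KERNEL-EXACT, in the skeleton's own context

Crux `ByReductionTypeAtTwo.OrdKatoHalfAtTwoIso` (stmt-BirchSwinnertonDyer-19573), PICKED line `steinberg-fibre-at-two`. Companion of `Cert54a.lean`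
(same 40 skeleton imports + the doors module; here additionally cruxlead-19573-w3 g7's LANDED Literature file p738189
`Kato2004/IwasawaH1FreeOfNoRationalTorsionProofs` = Kato Thm. 12.4 (3) at EVERY `p` for the pinned `𝐇¹_Γ(T_pW)` when `W(ℚ)[p] = 0`, and the
18:43Z APPEND to `…GreenbergMuNegDefs` displaying N2D⁻ `ZetaNotTwoDivisibleTwoOrdNegDisc`). Events E54.1/E54.2 of TRIAGE-r1-2.md GEN 54, folded BY TYPE.

CONTENT (one-line compositions BY NAME; no `sorry`; the def `VflatNegRegistered` is the LEDGER text of v24's `stub_muFreeValue_negDisc_two`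
pasted verbatim, as in Cert54a):
* `mu13neg_iff_n2dneg (h12 : thm12_4) : ZetaQuotientMuZeroTwoOrdNegDisc ↔ ZetaNotTwoDivisibleTwoOrdNegDisc` — MU13⁻ ⟺ N2D⁻ curve by curve,
  carrier by carrier, class by class (w3's pointwise iff `μ(𝐇¹_Γ ⧸ Λz) = 0 ⟺ z ∉ 2·𝐇¹_Γ` — VENDORED below against built constants, since the
  farm build of p738189's module lags its tree text (§4 unbuilt at 18:57Z/19:08Z) — with irreducibility of `W[2]` from `ρ̄₂` onto).
* `vflatNegRegistered_iff_g11neg_and_n2dneg` : V♭⁻(registered) ⟺ G11⁻ ∧ N2D⁻ modulo {PT-exact p729889, hOK p727215, `thm12_4`, PUB} — so the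
  EXACT excess of the registered memo stub over Greenberg's Conjecture 1.11 at `2` (Δ < 0 cell) is «a genuine class `∉ 2·𝐇¹_Γ` at every cell
  curve», the binder-for-binder negation of the `hdiv` hypothesis of the disprover's Negative lemma p691215.
* `n2dneg_of_vflatNegRegistered` : the (⇒) projection BY NAME.
HONEST STATUS: nothing here asserts V♭⁻, G11⁻, MU13⁻, N2D⁻, PT-exact, PUB, `thm12_4` or the crux; implications/equivalences between displayed
OPEN statements only; BSD is NOT proved; crux 202 is OPEN; skeleton v24 untouched (this file is NOT a skeleton and registers nothing).
-/
set_option autoImplicit false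
set_option linter.dupNamespace false

noncomputable section

open scoped Classical MatrixGroups ModularForm NumberField
open CongruenceSubgroup WeierstrassCurve Field IsDedekindDomain
open Literature.NumberTheory.GaloisRepresentations
open Literature.NumberTheory.EllipticCurves Literature.NumberTheory.EllipticCurves.ModularForms
open Literature.NumberTheory.EllipticCurves.Kato2004
  Literature.NumberTheory.EllipticCurves.Kato2004.EulerSystemValues
open Literature.NumberTheory.EllipticCurves.Rank1Residual
open Summit.BirchSwinnertonDyer.BirchSwinnertonDyer.Theorems.Rank1ResidualX1Defs
  Summit.BirchSwinnertonDyer.BirchSwinnertonDyer.Rank1Residual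
open Summit.BirchSwinnertonDyer.Rank1Residual Summit.BirchSwinnertonDyer.Rank1Residual.X5
open Summit.BirchSwinnertonDyer.BirchSwinnertonDyer.Theorems.OrdKatoOptimalAtTwo
  Summit.BirchSwinnertonDyer.BirchSwinnertonDyer.Theorems.OrdKatoIntAtTwo
open Summit.BirchSwinnertonDyer.BirchSwinnertonDyer.Theses.ByReductionTypeAtTwo
open Summit.BirchSwinnertonDyer.BirchSwinnertonDyer.Theorems.SteinbergFibreAtTwo
open Literature.NumberTheory.EllipticCurves.Greenberg1999 Literature.NumberTheory.IwasawaTheory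
open Literature.NumberTheory.GaloisCohomology Literature.NumberTheory.EllipticCurves.GreenbergSelmer
  Literature.NumberTheory.EllipticCurves.IwasawaDual


namespace Summit.BirchSwinnertonDyer.BirchSwinnertonDyer.Cruxes.OrdKatoHalfAtTwoIso.SteinbergFibreAtTwo

namespace Cert54b

/-- LEDGER text of the registered stub `stub_muFreeValue_negDisc_two` (V♭⁻) of skeleton v24 `4921f2ec…`, pasted VERBATIM (1181 chars normalised). -/
def VflatNegRegistered : Prop :=
  ∀ (W : WeierstrassCurve ℚ) [W.IsElliptic] [W.IsGloballyMinimal] [ContinuousSMul ℤ_[2] (W.tateModule 2)] [Module.Free ℤ_[2] (W.tateModule 2)] [Module.Finite ℤ_[2] (W.tateModule 2)] {N : ℕ} [NeZero N] (f : CuspForm (Gamma0 N) 2) (κ : ZpExtension ℚ 2) (γ : absoluteGaloisGroup ℚ) (hκ : κ.IsCyclotomic) (hγ : κ.IsTopGenerator γ), W.Δ < 0 → IsOrdinaryAt W 2 → W.HasSurjectiveModNGaloisRep 2 → IsCyclotomicVariable 2 γ → IsNewformOf W f → ∀ (v₂ : HeightOneSpectrum (𝓞 ℚ)) (_ : ((2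 : ℕ) : 𝓞 ℚ) ∈ v₂.asIdeal) (γᵥ : absoluteGaloisGroup (v₂.adicCompletion ℚ)) (hsurj : Function.Surjective (κ.toContinuousMonoidHom.comp (resGalOfEmb (closureEmb (K := ℚ) (v₂.adicCompletion ℚ))))) (hγᵥ : κ.IsTopGenerator (resGalOfEmb (closureEmb (K := ℚ) (v₂.adicCompletion ℚ)) γᵥ)) (I : IwasawaH1Data W 2 κ γ) (J : LocalIwasawaH1Data κ v₂ ((tateRep W 2).toLocal v₂) γᵥ) (J' : LocalIwasawaH1Data κ v₂ (tateLocalOrdinaryRep W 2 v₂) γᵥ) (col : J.H →ₗ[IwasawaAlgebra 2] IwasawaAlgebra 2), (∀ x : J.H, col x = 0 ↔ x ∈ LinearMap.range (J'.ordinaryInclusion J)) → (∃ x : J.H, col x ∉ IwasawaAlgebra.augIdealP 2) → ∃ g : I.H, IsEulerSystemClassTwo W hκ I g ∧ col (I.loc J hsurj hγ hγᵥ g) ∉ IwasawaAlgebra.augIdealP 2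


/-! ### Vendored from the TREE TEXT of p738189's file (`Kato2004/IwasawaH1FreeOfNoRationalTorsionProofs.lean` §4, ll. 255–309, author
cruxlead-19573-w3 g7), because the farm build of that module served at 18:57Z / 19:08Z (module idx 12447) carries §1–§3 only (6 constants:
`Probe54c.lean`). The two statements below are w3's, re-proved here against BUILT constants only; delete in favour of the tree names
(`moduleFinite_quotient_span_of_generator_of_not_mem_augIdealP_smul_top`, `IwasawaH1Data.moduleFinite_quotient_span_iff_not_mem_smul_top`) once built. -/

/-- (vendored, w3 g7) On a torsion-free cyclic `Λ`-module `M = Λ·e`, a class NOT divisible by `p` has `M ⧸ Λz` finitely generated over `ℤ_p`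
(`z = β • e` with `β ∉ (p)`, `M ≃ Λ`, `M ⧸ Λz ≅ Λ ⧸ (β)`, Weierstrass preparation via `moduleFinite_quotient_span_of_notMem_augIdealP`).
[cite: Washington1997, §7.1 Thm. 7.3, §13.2] -/
theorem moduleFinite_quotient_span_of_generator_of_not_mem_augIdealP_smul_top_v {p : ℕ} [Fact p.Prime] {M : Type*} [AddCommGroup M]
    [Module (IwasawaAlgebra p) M] [NoZeroSMulDivisors (IwasawaAlgebra p) M]
    {e : M} (he : e ≠ 0) (hgen : ∀ x : M, ∃ a : IwasawaAlgebra p, x = a • e) {z : M}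
    (hz : z ∉ IwasawaAlgebra.augIdealP p • (⊤ : Submodule (IwasawaAlgebra p) M)) :
    Module.Finite ℤ_[p] (RestrictScalars ℤ_[p] (IwasawaAlgebra p) (M ⧸ (IwasawaAlgebra p) ∙ z)) := by
  -- `M ≃ Λ` through the generator
  have hinj : Function.Injective (LinearMap.toSpanSingleton (IwasawaAlgebra p) M e) :=
    smul_left_injective (IwasawaAlgebra p) he
  have hsurj : Function.Surjective (LinearMap.toSpanSingleton (IwasawaAlgebra p) M e) := by
    intro x
    obtain ⟨a, rfl⟩ := hgen x
    exact ⟨a, rfl⟩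
  let ψ : M ≃ₗ[IwasawaAlgebra p] IwasawaAlgebra p :=
    (LinearEquiv.ofBijective (LinearMap.toSpanSingleton (IwasawaAlgebra p) M e) ⟨hinj, hsurj⟩).symm
  have hψ : ∀ a : IwasawaAlgebra p, ψ (a • e) = a := fun a =>
    (LinearEquiv.symm_apply_eq _).mpr rfl
  obtain ⟨β, hβ⟩ := hgen z
  have hβp : β ∉ IwasawaAlgebra.augIdealP p := by
    intro hmem
    apply hz
    rw [IwasawaAlgebra.augIdealP, Ideal.mem_span_singleton'] at hmem
    obtain ⟨c, rfl⟩ := hmem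
    rw [hβ, mul_comm, mul_smul, IwasawaAlgebra.augIdealP]
    exact Submodule.smul_mem_smul (Ideal.mem_span_singleton_self _) Submodule.mem_top
  have hspan : Submodule.span (IwasawaAlgebra p) ({e} : Set M) = ⊤ :=
    eq_top_iff.mpr fun x _ => by
      obtain ⟨a, rfl⟩ := hgen x
      exact Submodule.smul_mem _ a (Submodule.subset_span rfl)
  have hrk : Module.rank (IwasawaAlgebra p) M ≤ 1 := by
    rw [← rank_top, ← hspan]
    exact (rank_span_le _).trans (by rw [Cardinal.mk_singleton])
  refine moduleFinite_quotient_span_of_notMem_augIdealP hrk ψ.toLinearMap z ?_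
  change ψ z ∉ _
  rwa [hβ, hψ]

/-- (vendored, w3 g7) **On the pinned `𝐇¹_Γ(T_pW)` with `W[p]` irreducible: `μ(𝐇¹_Γ ⧸ Λz) = 0 ⟺ z ∉ p·𝐇¹_Γ`**, granted the rank clause of
Kato Thm. 12.4 (2) (`thm12_4`): ⇒ is `IwasawaH1Data.not_mem_augIdealP_smul_top_of_moduleFinite_quotient_span_of_thm12_4` (p736999, built),
⇐ is FREENESS (`IwasawaH1Data.moduleFree_of_hasIrreducibleModPGaloisRep`, p738189 §2, built) + a generator
(`exists_generator_of_moduleFree_of_rank_eq_one`, §3, built) + the lemma above. [cite: Kato2004Asterisque, Thm. 12.4 (2)(3) (p. 221), §13.8 (pp. 228–229)] -/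
theorem moduleFinite_quotient_span_iff_not_mem_smul_top_v {p : ℕ} [Fact p.Prime] (h12 : thm12_4)
    {W : WeierstrassCurve ℚ} [W.IsElliptic] [ContinuousSMul ℤ_[p] (W.tateModule p)]
    {κ : ZpExtension ℚ p} {γ : absoluteGaloisGroup ℚ} (hκ : κ.IsCyclotomic) (hγ : κ.IsTopGenerator γ)
    (I : IwasawaH1Data W p κ γ) (hirr : W.HasIrreducibleModPGaloisRep p) (z : I.H) :
    Module.Finite ℤ_[p] (RestrictScalars ℤ_[p] (IwasawaAlgebra p) (I.H ⧸ (IwasawaAlgebra p) ∙ z)) ↔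
      z ∉ IwasawaAlgebra.augIdealP p • (⊤ : Submodule (IwasawaAlgebra p) I.H) := by
  refine ⟨fun hfin => I.not_mem_augIdealP_smul_top_of_moduleFinite_quotient_span_of_thm12_4 h12 hκ hγ hfin, fun hz => ?_⟩
  haveI := I.noZeroSMulDivisors hγ
  haveI := I.moduleFree_of_hasIrreducibleModPGaloisRep hκ hγ hirr
  obtain ⟨-, ⟨-, hrk⟩, -⟩ := h12 W p κ γ hκ hγ I
  obtain ⟨e, he, hgen⟩ := exists_generator_of_moduleFree_of_rank_eq_one hrk
  exact moduleFinite_quotient_span_of_generator_of_not_mem_augIdealP_smul_top_v he hgen hz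

/-- **MU13⁻ ⟺ N2D⁻** granted the rank clause of Kato Thm. 12.4 (2) (`thm12_4`, print, every `p`): pointwise in `(W, κ, γ, I, z)` by
`moduleFinite_quotient_span_iff_not_mem_smul_top_v` (= w3's §4, vendored: `𝐇¹_Γ(T₂W)` is Λ-free for irreducible `W[2]` — Kato 12.4 (3) at
`p = 2`, p738189 §2 — and on `Λ·e`, `μ(Λe ⧸ Λz) = 0 ⟺ z ∉ 2Λe`), with irreducibility of `W[2]` from `ρ̄_{W,2}` onto. [folklore] -/
theorem mu13neg_iff_n2dneg (h12 : thm12_4) : ZetaQuotientMuZeroTwoOrdNegDisc ↔ ZetaNotTwoDivisibleTwoOrdNegDisc := by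
  constructor
  · intro h W _ _ _ _ _ κ γ hκ hγ hΔ hord hsurj hcv I
    obtain ⟨z, hz, hfin⟩ := h W κ γ hκ hγ hΔ hord hsurj hcv I
    exact ⟨z, hz, (moduleFinite_quotient_span_iff_not_mem_smul_top_v h12 hκ hγ I
      (hasIrreducibleModPGaloisRep_of_hasSurjectiveModNGaloisRep W 2 hsurj) z).mp hfin⟩
  · intro h W _ _ _ _ _ κ γ hκ hγ hΔ hord hsurj hcv I
    obtain ⟨z, hz, hnd⟩ := h W κ γ hκ hγ hΔ hord hsurj hcv I
    exact ⟨z, hz, (moduleFinite_quotient_span_iff_not_mem_smul_top_v h12 hκ hγ I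
      (hasIrreducibleModPGaloisRep_of_hasSurjectiveModNGaloisRep W 2 hsurj) z).mpr hnd⟩

/-- **V♭⁻ (registered ledger text of v24's `stub_muFreeValue_negDisc_two`) ⟺ G11⁻ ∧ N2D⁻** modulo the cite-tier objects already on the line
{PT-exact p729889, hOK p727215 (= `stub_ordKernelFunctional`), `thm12_4`, PUB}: w3 g7's `muFreeValue_negDisc_iff_greenbergMuNeg_and_zetaQuotientMu`
(p737300, LHS = the registered text, definitional match) followed by `mu13neg_iff_n2dneg`. [folklore] -/
theorem vflatNegRegistered_iff_g11neg_and_n2dneg (hPT : exists_lambdaAdicLocalTatePairing_poitouTate_exact)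
    (hOK : exists_ordinaryKernelFunctional) (h12 : thm12_4) (hPub : OrdPublishedInputsAtTwo) :
    VflatNegRegistered ↔ (GreenbergMuZeroTwoOrdNegDisc ∧ ZetaNotTwoDivisibleTwoOrdNegDisc) :=
  (muFreeValue_negDisc_iff_greenbergMuNeg_and_zetaQuotientMu hPT hOK h12 hPub).trans (and_congr Iff.rfl (mu13neg_iff_n2dneg h12))

/-- The (⇒) projection BY NAME: V♭⁻(registered) + hOK + PUB + `thm12_4` ⟹ N2D⁻. [folklore] -/
theorem n2dneg_of_vflatNegRegistered (h12 : thm12_4) (hOK : exists_ordinaryKernelFunctional) (hPub : OrdPublishedInputsAtTwo)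
    (hV : VflatNegRegistered) : ZetaNotTwoDivisibleTwoOrdNegDisc :=
  (mu13neg_iff_n2dneg h12).mp (zetaQuotientMuZeroTwoOrdNegDisc_of_muFreeValue_negDisc h12 hOK hPub hV)

#print axioms mu13neg_iff_n2dneg
#print axioms vflatNegRegistered_iff_g11neg_and_n2dneg
#print axioms n2dneg_of_vflatNegRegistered

end Cert54b

end Summit.BirchSwinnertonDyer.BirchSwinnertonDyer.Cruxes.OrdKatoHalfAtTwoIso.SteinbergFibreAtTwo
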